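import Literature.MathematicalPhysics.QuantumFieldTheory.Balaban1983to89.B3Op116SliceSums

/-!
# `Balaban1983to89.B3Op116FaceSums` — T. Bałaban, *(Higgs)₂,₃ quantum fields in a finite volume. III. Renormalization*,
# Commun. Math. Phys. **88** (1983) 411–445 [Balaban1983Higgs3], (1.16) p. 414 / (2.6), (2.10) pp. 424–426 / p. 433:
# **THE FACE CONVOLUTION OF TWO (2.6)/(2.10) MAJORANTS** — a single layer on a boundary hyperplane of a box `□`, whose density is a majorant
# of exponent `a₂`, read through a kernel majorized with exponent `a₁`, is a majorant of exponent `a₁ + a₂ − 1` at half the rate (`a₁, a₂ > 1`);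
# and **THE COMPOSED («PENDING-SHEET») STEP**: the same sheet read through a DIFFERENTIATED column (exponent one — the borderline) and then
# through the next kernel is again a majorant, uniformly in all positions — the order of summation removes the boundary-layer logarithm

statement-level skeleton of published theorems with citation tags; proofs where landed; nothing here is a claim about the Yang–Mills mass gap

PDF held: `paper:balaban1983-higgs-2-3-quantum-fields-finite-volume` p. 414 [PDF 4], p. 424 [14], p. 426 [16], pp. 432–433 [22–23];
`paper:balaban1983-cmp89-regularity-decay` Sect. 5 p. 594.

CITATION HEADER (lean-in-tree rule).  T. Bałaban, CMP **88** (1983) 411–445 [Balaban1983Higgs3]: (1.16) p. 414, (2.5)/(2.6) p. 424, (2.10) p. 426,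
p. 433; T. Bałaban, CMP **89** (1983) 571–597 [Balaban1983RegularityDecay], Sect. 5 Theorem p. 594.  Cell `lit-balaban` (HOME
`run/shared/lean/pub/lit-balaban/`), Phase-2 proof seat **p35** gen 26 (literature-prover-lit-balaban-p35-g26-0; free-target protocol G.5-34(d), TAKING
HOME/STATUS.md 2026-08-23T12:38:30Z, cc p40 / p33 / r14 / r15).  SKELETON rows **B3.Eq1.16** / **B3.Eq2.5** / **B3.Txt@433** / **B3.Prop1** (owner r15) —
LOCATED ENGINE FILE, no head claim: file 2/3 of the face-sheet engine of the «(2.5) for (1.16) on a cell-product box `□` without the support clause»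
programme (GAPS.md G-B3-16 ADDENDUM 1 = G-B3-16.A1, owner countersign 2026-08-23T12:25:18Z; p35 `DESIGN-FILE4.md` §14; p40 `DESIGN-B3-116-box.md`
§2a/§2b).  Imports `B3Op116SliceSums` (file 1/3: slice sums, two bumps over a face, the face scale algebra) and through it p33's
`B3Op116MajorantConvolution` (`conv_majorant_le`, `sum_sq_le_lower_add_upper`, `sum_range_succ_mesh_rpow_le`, `majorant_rate_mono`), never restated.

WHAT IS PRINTED (verbatim).  p. 414 [PDF 4]: *"the Hölder norms of the covariant derivatives of this kernel … are exponentially decaying with the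
distance of the arguments and are uniformly bounded by O(1)(e(L^kε)^{1−α})^{n+n′}"*; p. 433 [PDF 23]: *"we take a cube □ of size 3r(L^kε) … We have
B̃ = B̃₀ + B̃′, and we expand in B̃′ … we include the operators (1.16) … into the external fields"* — on the cube the Leibniz form of the sources of
`V_k(B̃′, B̃₀)` leaves single layers on `∂□` (G-B3-16.A1); (2.6) p. 424 *"G_k(Ω,B̃) = Σ_{j=0}^{k−1} G^η_{(j)}(Ω,B̃)"*, (2.10) p. 426 (the per-scale bounds).

THE CURRENCY (r14 FILE E / p35 `B3Op116MajorantStep`, used verbatim): `𝔪(c, a; δ)(x, y) := Σ_{j<k} c·(L^jε)^{a−d}·exp(−δ(L^jε)^{−1}ε|x−y|)`.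

WHAT THIS FILE PROVES (pure lattice-sum lemmas on `T_ε = HiggsLattice.Site P 0`; `F` any set of sites inside one hyperplane `{u : u_ν = c}`).
* §3 **`face_conv_majorant_le`** — for `a₁, a₂ > 1`, `0 < δ ≤ 1`, `L > 1`:
  `Σ_{u∈F} 𝔪(c₁,a₁;δ)(x,u)·𝔪(c₂,a₂;δ)(u,y) ≤ 𝔪(c₁c₂(8d/δ)^{d−1}(ε^{d−1})^{−1}(L^{a₁−1}(L^{a₁−1}−1)^{−1} + L^{a₂−1}(L^{a₂−1}−1)^{−1}), a₁+a₂−1; δ/2)(x,y)`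
  (p33's `conv_majorant_le` with the `(d−1)`-volume of file 1: the pair of scales filed under its coarser index, the finer index summed geometrically with
  the exponent `a_i − 1 > 0`); `face_sum_kernel_mul_le` (kernel form); `surface_bookkeeping` (`ε^d·ε⁻¹·(ε^{d−1})⁻¹ = 1`: a face charge `ε⁻¹(…)` read
  through a column whose majorant constant carries `ε^d` against the `(ε^{d−1})^{−1}` of the lemma is `ε`-free — p40 `DESIGN-B3-116-box.md` §2a).
* §5 **`sum_majorant_face_pending_le`** — for `p > 0`, `s > 1`: `Σ_b 𝔪(c₀,p;δ)(z,b)·[Σ_{u∈F} 𝔪(c₁,1;δ)(b,u)·S(u)] ≤ 𝔪(C, p+s; δ/4)(z,y)` whenever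
  `0 ≤ S ≤ 𝔪(c₂,s;δ)(·,y)` on `F` (Fubini; p33's `conv_majorant_le` with exponents `(p,1)`; §3 with exponents `(p+1, s)`): the sheet that a
  DIFFERENTIATED column (exponent `1`: §3 does not apply, and the direct sum is logarithmic in `L^k/dist(b,∂□)` — file 3/3) picks up is harmless once
  composed with the NEXT kernel of the chain, for every position of the intermediate bond — the «pending-sheet» component of `DESIGN-FILE4.md` §14 (d).
HONEST SCOPE.  Nothing of (1.16) itself is asserted; which sheets occur (the entering / exiting legs of the Leibniz rows restricted to the bonds of `□`,
p40 `DESIGN-B3-116-box.md` §1c) and the three-component state recursion are the sequel files F2–F6 of `DESIGN-FILE4.md` §14 (not in the tree).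
Constants not optimized; `nCol N` enters §5 through p33's torus profile.  Theorems only: no `def`, no `def … : Prop`, no `sorry`; axioms standard.
-/

noncomputable section

open scoped BigOperators

namespace Literature.MathematicalPhysics.QuantumFieldTheory.Balaban1983to89.B3Op116FaceSums

open B1Eq230FluctCov (Ix)
open B1Ineq234Concrete (nCol)
open B3Op116ScaleChains (rate_eq mesh_rpow_add)
open B3Op116MajorantConvolution (majorant_rate_mono majorant_nonneg sum_sq_le_lower_add_upper sum_range_succ_mesh_rpow_le conv_majorant_le)
open B3Op116SliceSums (face_conv2_scales_le face_pair_scale_algebra)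

variable {P : HiggsLattice.Params} {N : ℕ}

/-! ## §3 CLOSURE: two majorants summed over a face give a majorant — exponents add MINUS ONE, the rate halves -/

section FaceClosure

/-- **THE FACE CONVOLUTION OF TWO MAJORANTS.**  For exponents `a₁, a₂ > 1`, `0 < δ ≤ 1`, `L > 1`, and a set of sites `F` inside one lattice
hyperplane `{u : u_ν = c}` of `T_ε` (a face of a cell-product box, a piece of its boundary):
`Σ_{u∈F} 𝔪(c₁,a₁;δ)(x,u)·𝔪(c₂,a₂;δ)(u,y) ≤ 𝔪(c₁c₂·(8d/δ)^{d−1}(ε^{d−1})^{−1}·(L^{a₁−1}(L^{a₁−1}−1)^{−1} + L^{a₂−1}(L^{a₂−1}−1)^{−1}), a₁ + a₂ − 1; δ/2)(x,y)`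
— the pattern of p33's `conv_majorant_le` with the `(d−1)`-volume of §2: each pair of scales is filed under its coarser index and the finer index is summed
geometrically with the exponent `a_i − 1 > 0`.  With the surface measure `ε^{d−1}` of a sheet this says: a single layer whose density is a majorant of
exponent `a₂`, read through a kernel of exponent `a₁`, is a majorant of exponent `a₁ + a₂ − 1` — for `a₁ = 2` (a VALUE column) the next value state,
for `a₁ = 1` (a DIFFERENTIATED column) the hypothesis fails: that borderline is §6.
[cite: Balaban1983Higgs3, (1.16) p.414, (2.6) p.424, (2.10) p.426] [cite: Balaban1983RegularityDecay, Sect. 5 Theorem p.594] -/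
theorem face_conv_majorant_le (hL : 1 < P.L) {k : ℕ} {δ : ℝ} (hδ : 0 < δ) (hδ1 : δ ≤ 1) {a₁ a₂ c₁ c₂ : ℝ}
    (ha₁ : 1 < a₁) (ha₂ : 1 < a₂) (hc₁ : 0 ≤ c₁) (hc₂ : 0 ≤ c₂)
    {F : Finset (HiggsLattice.Site P 0)} {ν : Fin P.d} {c : ZMod (P.sitesPerDir 0 ν)} (hF : ∀ s ∈ F, s ν = c)
    (x y : HiggsLattice.Site P 0) :
    ∑ u ∈ F,
        (∑ j ∈ Finset.range k, c₁ * P.mesh j ^ (a₁ - (P.d : ℝ)) *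
            Real.exp (-(δ * (P.mesh j)⁻¹ * (P.mesh 0 * (HiggsLattice.Site.tdist x u : ℝ))))) *
        (∑ j ∈ Finset.range k, c₂ * P.mesh j ^ (a₂ - (P.d : ℝ)) *
            Real.exp (-(δ * (P.mesh j)⁻¹ * (P.mesh 0 * (HiggsLattice.Site.tdist u y : ℝ)))))
      ≤ ∑ j ∈ Finset.range k, (c₁ * c₂ * ((8 * P.d / δ) ^ (P.d - 1) * (P.mesh 0 ^ (P.d - 1))⁻¹ *
            ((P.L : ℝ) ^ (a₁ - 1) / ((P.L : ℝ) ^ (a₁ - 1) - 1) + (P.L : ℝ) ^ (a₂ - 1) / ((P.L : ℝ) ^ (a₂ - 1) - 1)))) *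
          P.mesh j ^ (a₁ + a₂ - 1 - (P.d : ℝ)) *
          Real.exp (-(δ / 2 * (P.mesh j)⁻¹ * (P.mesh 0 * (HiggsLattice.Site.tdist x y : ℝ)))) := by
  have hL1 : (1 : ℝ) < (P.L : ℝ) := by exact_mod_cast hL
  have hL0 : (0 : ℝ) ≤ (P.L : ℝ) := Nat.cast_nonneg _
  have hm : ∀ j, 0 < P.mesh j := P.mesh_pos
  have ha₁' : 0 < a₁ - 1 := by linarith
  have ha₂' : 0 < a₂ - 1 := by linarith
  -- abbreviations
  set E : ℕ → HiggsLattice.Site P 0 → HiggsLattice.Site P 0 → ℝ :=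
    fun j u v => Real.exp (-(δ * (P.mesh j)⁻¹ * (P.mesh 0 * (HiggsLattice.Site.tdist u v : ℝ)))) with hE
  set E2 : ℕ → ℝ := fun j => Real.exp (-(δ / 2 * (P.mesh j)⁻¹ * (P.mesh 0 * (HiggsLattice.Site.tdist x y : ℝ)))) with hE2
  have hE20 : ∀ j, 0 ≤ E2 j := fun j => Real.exp_nonneg _
  set K₀ : ℝ := (8 * P.d / δ) ^ (P.d - 1) with hK₀
  have hK₀0 : 0 ≤ K₀ := by rw [hK₀]; positivity
  set G₁ : ℝ := (P.L : ℝ) ^ (a₁ - 1) / ((P.L : ℝ) ^ (a₁ - 1) - 1) with hG₁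
  set G₂ : ℝ := (P.L : ℝ) ^ (a₂ - 1) / ((P.L : ℝ) ^ (a₂ - 1) - 1) with hG₂
  have hG₁0 : 0 ≤ G₁ := by
    have := Real.one_lt_rpow hL1 ha₁'; rw [hG₁]; exact div_nonneg (by linarith) (by linarith)
  have hG₂0 : 0 ≤ G₂ := by
    have := Real.one_lt_rpow hL1 ha₂'; rw [hG₂]; exact div_nonneg (by linarith) (by linarith)
  -- the pair term after the face sum
  set g : ℕ → ℕ → ℝ := fun j₁ j₂ =>
    P.mesh j₁ ^ a₁ * P.mesh j₂ ^ a₂ * (P.mesh (max j₁ j₂) ^ P.d)⁻¹ * (P.mesh (min j₁ j₂))⁻¹ * E2 (max j₁ j₂) with hg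
  have hg0 : ∀ j₁ j₂, 0 ≤ g j₁ j₂ := fun j₁ j₂ => by
    rw [hg]
    exact mul_nonneg (mul_nonneg (mul_nonneg (mul_nonneg (Real.rpow_nonneg (hm j₁).le _) (Real.rpow_nonneg (hm j₂).le _))
      (inv_nonneg.mpr (pow_nonneg (hm _).le _))) (inv_nonneg.mpr (hm _).le)) (hE20 _)
  -- Step 1: expand the two scale sums and bring the face sum inside
  have step1 : ∑ u ∈ F,
        (∑ j ∈ Finset.range k, c₁ * P.mesh j ^ (a₁ - (P.d : ℝ)) * E j x u) *
        (∑ j ∈ Finset.range k, c₂ * P.mesh j ^ (a₂ - (P.d : ℝ)) * E j u y)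
      = ∑ j₁ ∈ Finset.range k, ∑ j₂ ∈ Finset.range k,
          c₁ * c₂ * (P.mesh j₁ ^ (a₁ - (P.d : ℝ)) * P.mesh j₂ ^ (a₂ - (P.d : ℝ))) *
            ∑ u ∈ F, E j₁ x u * E j₂ u y := by
    calc ∑ u ∈ F,
          (∑ j ∈ Finset.range k, c₁ * P.mesh j ^ (a₁ - (P.d : ℝ)) * E j x u) *
          (∑ j ∈ Finset.range k, c₂ * P.mesh j ^ (a₂ - (P.d : ℝ)) * E j u y)
        = ∑ u ∈ F, ∑ j₁ ∈ Finset.range k, ∑ j₂ ∈ Finset.range k,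
            c₁ * c₂ * (P.mesh j₁ ^ (a₁ - (P.d : ℝ)) * P.mesh j₂ ^ (a₂ - (P.d : ℝ))) * (E j₁ x u * E j₂ u y) := by
          refine Finset.sum_congr rfl fun u _ => ?_
          rw [Finset.sum_mul_sum]
          refine Finset.sum_congr rfl fun j₁ _ => Finset.sum_congr rfl fun j₂ _ => ?_
          ring
      _ = ∑ j₁ ∈ Finset.range k, ∑ u ∈ F, ∑ j₂ ∈ Finset.range k,
            c₁ * c₂ * (P.mesh j₁ ^ (a₁ - (P.d : ℝ)) * P.mesh j₂ ^ (a₂ - (P.d : ℝ))) * (E j₁ x u * E j₂ u y) :=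
          Finset.sum_comm
      _ = ∑ j₁ ∈ Finset.range k, ∑ j₂ ∈ Finset.range k, ∑ u ∈ F,
            c₁ * c₂ * (P.mesh j₁ ^ (a₁ - (P.d : ℝ)) * P.mesh j₂ ^ (a₂ - (P.d : ℝ))) * (E j₁ x u * E j₂ u y) :=
          Finset.sum_congr rfl fun j₁ _ => Finset.sum_comm
      _ = _ := by
          refine Finset.sum_congr rfl fun j₁ _ => Finset.sum_congr rfl fun j₂ _ => ?_
          rw [Finset.mul_sum]
  -- Step 2: each pair of scales (§2 + the face scale algebra)
  have step2 : ∀ j₁ j₂ : ℕ,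
      c₁ * c₂ * (P.mesh j₁ ^ (a₁ - (P.d : ℝ)) * P.mesh j₂ ^ (a₂ - (P.d : ℝ))) * ∑ u ∈ F, E j₁ x u * E j₂ u y
        ≤ c₁ * c₂ * K₀ * (P.mesh 0 ^ (P.d - 1))⁻¹ * g j₁ j₂ := by
    intro j₁ j₂
    have hconv := face_conv2_scales_le (P := P) hδ hδ1 j₁ j₂ hF x y
    have hpre : 0 ≤ c₁ * c₂ * (P.mesh j₁ ^ (a₁ - (P.d : ℝ)) * P.mesh j₂ ^ (a₂ - (P.d : ℝ))) :=
      mul_nonneg (mul_nonneg hc₁ hc₂) (mul_nonneg (Real.rpow_nonneg (hm j₁).le _) (Real.rpow_nonneg (hm j₂).le _))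
    calc c₁ * c₂ * (P.mesh j₁ ^ (a₁ - (P.d : ℝ)) * P.mesh j₂ ^ (a₂ - (P.d : ℝ))) * ∑ u ∈ F, E j₁ x u * E j₂ u y
        ≤ c₁ * c₂ * (P.mesh j₁ ^ (a₁ - (P.d : ℝ)) * P.mesh j₂ ^ (a₂ - (P.d : ℝ))) *
            (K₀ * ((P.L : ℝ) ^ (min j₁ j₂)) ^ (P.d - 1) * E2 (max j₁ j₂)) := mul_le_mul_of_nonneg_left hconv hpre
      _ = c₁ * c₂ * K₀ * (P.mesh j₁ ^ (a₁ - (P.d : ℝ)) * P.mesh j₂ ^ (a₂ - (P.d : ℝ)) * ((P.L : ℝ) ^ (min j₁ j₂)) ^ (P.d - 1)) *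
            E2 (max j₁ j₂) := by ring
      _ = c₁ * c₂ * K₀ * (P.mesh j₁ ^ a₁ * P.mesh j₂ ^ a₂ * (P.mesh (max j₁ j₂) ^ P.d)⁻¹ * (P.mesh (min j₁ j₂))⁻¹ *
            (P.mesh 0 ^ (P.d - 1))⁻¹) * E2 (max j₁ j₂) := by rw [face_pair_scale_algebra]
      _ = c₁ * c₂ * K₀ * (P.mesh 0 ^ (P.d - 1))⁻¹ * g j₁ j₂ := by rw [hg]; ring
  -- Step 3: the lower triangle (`j₂ ≤ j₁`: the pair lives at the scale `j₁`; the finer index carries `a₂ − 1 > 0`)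
  have step3 : ∀ j₁ : ℕ, ∑ j₂ ∈ Finset.range (j₁ + 1), g j₁ j₂
      ≤ G₂ * (P.mesh j₁ ^ (a₁ + a₂ - 1 - (P.d : ℝ)) * E2 j₁) := by
    intro j₁
    have hmax : ∀ j₂ ∈ Finset.range (j₁ + 1), g j₁ j₂
        = P.mesh j₁ ^ a₁ * (P.mesh j₁ ^ P.d)⁻¹ * E2 j₁ * P.mesh j₂ ^ (a₂ - 1) := by
      intro j₂ hj₂
      have h : max j₁ j₂ = j₁ := max_eq_left (by have := Finset.mem_range.1 hj₂; omega)
      have h' : min j₁ j₂ = j₂ := min_eq_right (by have := Finset.mem_range.1 hj₂; omega)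
      rw [hg]; simp only [h, h']
      rw [Real.rpow_sub_one (hm j₂).ne']
      field_simp
    rw [Finset.sum_congr rfl hmax, ← Finset.mul_sum]
    have hpre : 0 ≤ P.mesh j₁ ^ a₁ * (P.mesh j₁ ^ P.d)⁻¹ * E2 j₁ :=
      mul_nonneg (mul_nonneg (Real.rpow_nonneg (hm j₁).le _) (inv_nonneg.mpr (pow_nonneg (hm _).le _))) (hE20 _)
    calc P.mesh j₁ ^ a₁ * (P.mesh j₁ ^ P.d)⁻¹ * E2 j₁ * ∑ j₂ ∈ Finset.range (j₁ + 1), P.mesh j₂ ^ (a₂ - 1)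
        ≤ P.mesh j₁ ^ a₁ * (P.mesh j₁ ^ P.d)⁻¹ * E2 j₁ * (G₂ * P.mesh j₁ ^ (a₂ - 1)) :=
          mul_le_mul_of_nonneg_left (sum_range_succ_mesh_rpow_le hL ha₂' j₁) hpre
      _ = G₂ * ((P.mesh j₁ ^ a₁ * P.mesh j₁ ^ (a₂ - 1) * (P.mesh j₁ ^ P.d)⁻¹) * E2 j₁) := by ring
      _ = G₂ * (P.mesh j₁ ^ (a₁ + a₂ - 1 - (P.d : ℝ)) * E2 j₁) := by
          rw [mesh_rpow_add, Real.rpow_sub (hm j₁), Real.rpow_natCast, div_eq_mul_inv]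
          ring_nf
  -- Step 4: the upper triangle (`j₁ ≤ j₂`: the pair lives at the scale `j₂`; the finer index carries `a₁ − 1 > 0`)
  have step4 : ∀ j₂ : ℕ, ∑ j₁ ∈ Finset.range (j₂ + 1), g j₁ j₂
      ≤ G₁ * (P.mesh j₂ ^ (a₁ + a₂ - 1 - (P.d : ℝ)) * E2 j₂) := by
    intro j₂
    have hmax : ∀ j₁ ∈ Finset.range (j₂ + 1), g j₁ j₂
        = P.mesh j₂ ^ a₂ * (P.mesh j₂ ^ P.d)⁻¹ * E2 j₂ * P.mesh j₁ ^ (a₁ - 1) := by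
      intro j₁ hj₁
      have h : max j₁ j₂ = j₂ := max_eq_right (by have := Finset.mem_range.1 hj₁; omega)
      have h' : min j₁ j₂ = j₁ := min_eq_left (by have := Finset.mem_range.1 hj₁; omega)
      rw [hg]; simp only [h, h']
      rw [Real.rpow_sub_one (hm j₁).ne']
      field_simp
    rw [Finset.sum_congr rfl hmax, ← Finset.mul_sum]
    have hpre : 0 ≤ P.mesh j₂ ^ a₂ * (P.mesh j₂ ^ P.d)⁻¹ * E2 j₂ :=
      mul_nonneg (mul_nonneg (Real.rpow_nonneg (hm j₂).le _) (inv_nonneg.mpr (pow_nonneg (hm _).le _))) (hE20 _)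
    calc P.mesh j₂ ^ a₂ * (P.mesh j₂ ^ P.d)⁻¹ * E2 j₂ * ∑ j₁ ∈ Finset.range (j₂ + 1), P.mesh j₁ ^ (a₁ - 1)
        ≤ P.mesh j₂ ^ a₂ * (P.mesh j₂ ^ P.d)⁻¹ * E2 j₂ * (G₁ * P.mesh j₂ ^ (a₁ - 1)) :=
          mul_le_mul_of_nonneg_left (sum_range_succ_mesh_rpow_le hL ha₁' j₂) hpre
      _ = G₁ * ((P.mesh j₂ ^ (a₁ - 1) * P.mesh j₂ ^ a₂ * (P.mesh j₂ ^ P.d)⁻¹) * E2 j₂) := by ring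
      _ = G₁ * (P.mesh j₂ ^ (a₁ + a₂ - 1 - (P.d : ℝ)) * E2 j₂) := by
          rw [mesh_rpow_add, Real.rpow_sub (hm j₂), Real.rpow_natCast, div_eq_mul_inv]
          ring_nf
  -- Step 5: assemble
  have hpre : 0 ≤ c₁ * c₂ * K₀ * (P.mesh 0 ^ (P.d - 1))⁻¹ :=
    mul_nonneg (mul_nonneg (mul_nonneg hc₁ hc₂) hK₀0) (inv_nonneg.mpr (pow_nonneg (hm 0).le _))
  calc ∑ u ∈ F,
        (∑ j ∈ Finset.range k, c₁ * P.mesh j ^ (a₁ - (P.d : ℝ)) * E j x u) *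
        (∑ j ∈ Finset.range k, c₂ * P.mesh j ^ (a₂ - (P.d : ℝ)) * E j u y)
      = _ := step1
    _ ≤ ∑ j₁ ∈ Finset.range k, ∑ j₂ ∈ Finset.range k, c₁ * c₂ * K₀ * (P.mesh 0 ^ (P.d - 1))⁻¹ * g j₁ j₂ :=
        Finset.sum_le_sum fun j₁ _ => Finset.sum_le_sum fun j₂ _ => step2 j₁ j₂
    _ = c₁ * c₂ * K₀ * (P.mesh 0 ^ (P.d - 1))⁻¹ * ∑ j₁ ∈ Finset.range k, ∑ j₂ ∈ Finset.range k, g j₁ j₂ := by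
        simp_rw [Finset.mul_sum]
    _ ≤ c₁ * c₂ * K₀ * (P.mesh 0 ^ (P.d - 1))⁻¹ *
          ((∑ j₁ ∈ Finset.range k, ∑ j₂ ∈ Finset.range (j₁ + 1), g j₁ j₂)
            + ∑ j₂ ∈ Finset.range k, ∑ j₁ ∈ Finset.range (j₂ + 1), g j₁ j₂) :=
        mul_le_mul_of_nonneg_left (sum_sq_le_lower_add_upper k g hg0) hpre
    _ ≤ c₁ * c₂ * K₀ * (P.mesh 0 ^ (P.d - 1))⁻¹ *
          ((∑ j₁ ∈ Finset.range k, G₂ * (P.mesh j₁ ^ (a₁ + a₂ - 1 - (P.d : ℝ)) * E2 j₁))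
            + ∑ j₂ ∈ Finset.range k, G₁ * (P.mesh j₂ ^ (a₁ + a₂ - 1 - (P.d : ℝ)) * E2 j₂)) :=
        mul_le_mul_of_nonneg_left (add_le_add (Finset.sum_le_sum fun j₁ _ => step3 j₁)
          (Finset.sum_le_sum fun j₂ _ => step4 j₂)) hpre
    _ = ∑ j ∈ Finset.range k, (c₁ * c₂ * (K₀ * (P.mesh 0 ^ (P.d - 1))⁻¹ * (G₁ + G₂))) *
          P.mesh j ^ (a₁ + a₂ - 1 - (P.d : ℝ)) * E2 j := by
        rw [← Finset.sum_add_distrib, Finset.mul_sum]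
        exact Finset.sum_congr rfl fun j _ => by ring
    _ = _ := by rw [hK₀, hG₁, hG₂]


/-- **Kernel form**: nonnegative kernels `K(u) ≤ 𝔪(c₁,a₁;δ)(x,u)` and `S(u) ≤ 𝔪(c₂,a₂;δ)(u,y)` on a face `F ⊆ {u_ν = c}` (`a₁, a₂ > 1`) give
`Σ_{u∈F} K(u)S(u) ≤ 𝔪(c₁c₂(8d/δ)^{d−1}(ε^{d−1})^{−1}(…), a₁+a₂−1; δ/2)(x,y)` — a single layer of density `S` read through the column `K`.
[cite: Balaban1983Higgs3, (1.16) p.414, (2.6) p.424, (2.10) p.426] -/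
theorem face_sum_kernel_mul_le (hL : 1 < P.L) {k : ℕ} {δ : ℝ} (hδ : 0 < δ) (hδ1 : δ ≤ 1) {a₁ a₂ c₁ c₂ : ℝ}
    (ha₁ : 1 < a₁) (ha₂ : 1 < a₂) (hc₁ : 0 ≤ c₁) (hc₂ : 0 ≤ c₂)
    {F : Finset (HiggsLattice.Site P 0)} {ν : Fin P.d} {c : ZMod (P.sitesPerDir 0 ν)} (hF : ∀ s ∈ F, s ν = c)
    (x y : HiggsLattice.Site P 0) (K S : HiggsLattice.Site P 0 → ℝ) (hK0 : ∀ u ∈ F, 0 ≤ K u) (hS0 : ∀ u ∈ F, 0 ≤ S u)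
    (hK : ∀ u ∈ F, K u ≤ ∑ j ∈ Finset.range k, c₁ * P.mesh j ^ (a₁ - (P.d : ℝ)) *
      Real.exp (-(δ * (P.mesh j)⁻¹ * (P.mesh 0 * (HiggsLattice.Site.tdist x u : ℝ)))))
    (hS : ∀ u ∈ F, S u ≤ ∑ j ∈ Finset.range k, c₂ * P.mesh j ^ (a₂ - (P.d : ℝ)) *
      Real.exp (-(δ * (P.mesh j)⁻¹ * (P.mesh 0 * (HiggsLattice.Site.tdist u y : ℝ))))) :
    ∑ u ∈ F, K u * S u
      ≤ ∑ j ∈ Finset.range k, (c₁ * c₂ * ((8 * P.d / δ) ^ (P.d - 1) * (P.mesh 0 ^ (P.d - 1))⁻¹ *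
            ((P.L : ℝ) ^ (a₁ - 1) / ((P.L : ℝ) ^ (a₁ - 1) - 1) + (P.L : ℝ) ^ (a₂ - 1) / ((P.L : ℝ) ^ (a₂ - 1) - 1)))) *
          P.mesh j ^ (a₁ + a₂ - 1 - (P.d : ℝ)) *
          Real.exp (-(δ / 2 * (P.mesh j)⁻¹ * (P.mesh 0 * (HiggsLattice.Site.tdist x y : ℝ)))) := by
  refine le_trans (Finset.sum_le_sum fun u hu => ?_) (face_conv_majorant_le hL hδ hδ1 ha₁ ha₂ hc₁ hc₂ hF x y)
  exact mul_le_mul (hK u hu) (hS u hu) (hS0 u hu) ((hK0 u hu).trans (hK u hu))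

/-- **The surface bookkeeping**: a face charge `ε⁻¹·(…)` read through a column whose majorant constant carries `ε^d` (the matrix-entry
normalisation of the (2.10) dictionary) against the `(ε^{d−1})^{−1}` of §3 is `ε`-free: `ε^d·ε⁻¹·(ε^{d−1})⁻¹ = 1`.
[cite: Balaban1983Higgs3, (2.10) p.426] -/
theorem surface_bookkeeping : P.mesh 0 ^ P.d * (P.mesh 0)⁻¹ * (P.mesh 0 ^ (P.d - 1))⁻¹ = 1 := by
  have h0 : P.mesh 0 ≠ 0 := (P.mesh_pos 0).ne'
  have hsplit : P.mesh 0 ^ P.d = P.mesh 0 ^ (P.d - 1) * P.mesh 0 := by rw [← pow_succ, Nat.sub_add_cancel P.hd]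
  rw [hsplit]; field_simp

end FaceClosure

/-! ## §5 The COMPOSED form: a sheet read through an exponent-one column is harmless once composed with the next kernel -/

section Pending

/-- **The pending-sheet step.**  A single layer on a face `F ⊆ {u_ν = c}` with density `S ≤ 𝔪(c₂,s;δ)(·,y)`, `s > 1`, read through a column
`𝔪(c₁,1;δ)(b,·)` of exponent ONE (a differentiated propagator — the borderline of §3) and THEN through any kernel `𝔪(c₀,p;δ)(z,b)` of exponent `p > 0`
summed over all sites `b`, is a majorant of exponent `p + s` at rate `δ/4`:
`Σ_b 𝔪(c₀,p;δ)(z,b)·[Σ_{u∈F} 𝔪(c₁,1;δ)(b,u)·S(u)] ≤ 𝔪(C, p+s; δ/4)(z,y)`, `C = c₀c₁c₂·K_conv(p,1)·K_face(p+1,s)` —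
Fubini, p33's `conv_majorant_le` with exponents `(p, 1)` (output `p + 1 > 1`), then §3 with exponents `(p+1, s)`.  The logarithm of the absolute
bookkeeping of a sheet through a differentiated column (p40 `DESIGN-B3-116-box.md` §2b) is an artifact of taking the supremum over `b` first.
[cite: Balaban1983Higgs3, (1.16) p.414, (2.6) p.424, (2.10) p.426] [cite: Balaban1983RegularityDecay, Sect. 5 Theorem p.594] -/
theorem sum_majorant_face_pending_le (hL : 1 < P.L) {k : ℕ} {δ : ℝ} (hδ : 0 < δ) (hδ1 : δ ≤ 1) {p s c₀ c₁ c₂ : ℝ}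
    (hp : 0 < p) (hs : 1 < s) (hc₀ : 0 ≤ c₀) (hc₁ : 0 ≤ c₁) (hc₂ : 0 ≤ c₂) (i₀ : Ix N)
    {F : Finset (HiggsLattice.Site P 0)} {ν : Fin P.d} {c : ZMod (P.sitesPerDir 0 ν)} (hF : ∀ u ∈ F, u ν = c)
    (z y : HiggsLattice.Site P 0) (S : HiggsLattice.Site P 0 → ℝ) (hS0 : ∀ u ∈ F, 0 ≤ S u)
    (hS : ∀ u ∈ F, S u ≤ ∑ j ∈ Finset.range k, c₂ * P.mesh j ^ (s - (P.d : ℝ)) *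
      Real.exp (-(δ * (P.mesh j)⁻¹ * (P.mesh 0 * (HiggsLattice.Site.tdist u y : ℝ))))) :
    ∑ b : HiggsLattice.Site P 0,
        (∑ j ∈ Finset.range k, c₀ * P.mesh j ^ (p - (P.d : ℝ)) *
            Real.exp (-(δ * (P.mesh j)⁻¹ * (P.mesh 0 * (HiggsLattice.Site.tdist z b : ℝ))))) *
        (∑ u ∈ F, (∑ j ∈ Finset.range k, c₁ * P.mesh j ^ (1 - (P.d : ℝ)) *
            Real.exp (-(δ * (P.mesh j)⁻¹ * (P.mesh 0 * (HiggsLattice.Site.tdist b u : ℝ))))) * S u)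
      ≤ ∑ j ∈ Finset.range k,
          ((c₀ * c₁ * ((nCol N : ℝ) * (8 * P.d / δ) ^ P.d * (P.mesh 0 ^ P.d)⁻¹ *
              ((P.L : ℝ) ^ p / ((P.L : ℝ) ^ p - 1) + (P.L : ℝ) ^ (1:ℝ) / ((P.L : ℝ) ^ (1:ℝ) - 1)))) * c₂ *
            ((8 * P.d / (δ / 2)) ^ (P.d - 1) * (P.mesh 0 ^ (P.d - 1))⁻¹ *
              ((P.L : ℝ) ^ (p + 1 - 1) / ((P.L : ℝ) ^ (p + 1 - 1) - 1) + (P.L : ℝ) ^ (s - 1) / ((P.L : ℝ) ^ (s - 1) - 1)))) *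
          P.mesh j ^ (p + 1 + s - 1 - (P.d : ℝ)) *
          Real.exp (-(δ / 2 / 2 * (P.mesh j)⁻¹ * (P.mesh 0 * (HiggsLattice.Site.tdist z y : ℝ)))) := by
  have hL1 : (1 : ℝ) < (P.L : ℝ) := by exact_mod_cast hL
  have hδ2 : 0 < δ / 2 := by linarith
  have hδ21 : δ / 2 ≤ 1 := by linarith
  -- abbreviations
  set Mp : HiggsLattice.Site P 0 → ℝ := fun b => ∑ j ∈ Finset.range k, c₀ * P.mesh j ^ (p - (P.d : ℝ)) *
      Real.exp (-(δ * (P.mesh j)⁻¹ * (P.mesh 0 * (HiggsLattice.Site.tdist z b : ℝ)))) with hMp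
  set M1 : HiggsLattice.Site P 0 → HiggsLattice.Site P 0 → ℝ := fun b u => ∑ j ∈ Finset.range k, c₁ * P.mesh j ^ (1 - (P.d : ℝ)) *
      Real.exp (-(δ * (P.mesh j)⁻¹ * (P.mesh 0 * (HiggsLattice.Site.tdist b u : ℝ)))) with hM1
  set C₁ : ℝ := c₀ * c₁ * ((nCol N : ℝ) * (8 * P.d / δ) ^ P.d * (P.mesh 0 ^ P.d)⁻¹ *
      ((P.L : ℝ) ^ p / ((P.L : ℝ) ^ p - 1) + (P.L : ℝ) ^ (1:ℝ) / ((P.L : ℝ) ^ (1:ℝ) - 1))) with hC₁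
  -- the composed column `Σ_b 𝔪(p)(z,b)𝔪(1)(b,u) ≤ 𝔪(C₁, p+1; δ/2)(z,u)`
  set Mc : HiggsLattice.Site P 0 → ℝ := fun u => ∑ j ∈ Finset.range k, C₁ * P.mesh j ^ (p + 1 - (P.d : ℝ)) *
      Real.exp (-(δ / 2 * (P.mesh j)⁻¹ * (P.mesh 0 * (HiggsLattice.Site.tdist z u : ℝ)))) with hMc
  have hC₁0 : 0 ≤ C₁ := by
    have hG₁ : 0 ≤ (P.L : ℝ) ^ p / ((P.L : ℝ) ^ p - 1) := by
      have := Real.one_lt_rpow hL1 hp; exact div_nonneg (by linarith) (by linarith)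
    have hG₂ : 0 ≤ (P.L : ℝ) ^ (1:ℝ) / ((P.L : ℝ) ^ (1:ℝ) - 1) := by
      simp only [Real.rpow_one]
      exact div_nonneg (by linarith) (by linarith)
    have := inv_nonneg.mpr (pow_nonneg (P.mesh_pos 0).le P.d)
    rw [hC₁]; positivity
  have hcomp : ∀ u, ∑ b : HiggsLattice.Site P 0, Mp b * M1 b u ≤ Mc u := fun u =>
    conv_majorant_le hL hδ hδ1 hp one_pos hc₀ hc₁ i₀ z u
  -- the density at the halved rate
  set M2 : HiggsLattice.Site P 0 → ℝ := fun u => ∑ j ∈ Finset.range k, c₂ * P.mesh j ^ (s - (P.d : ℝ)) *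
      Real.exp (-(δ / 2 * (P.mesh j)⁻¹ * (P.mesh 0 * (HiggsLattice.Site.tdist u y : ℝ)))) with hM2
  have hS2 : ∀ u ∈ F, S u ≤ M2 u := fun u hu => (hS u hu).trans (majorant_rate_mono hc₂ (by linarith) u y)
  -- Fubini
  have hfub : ∑ b : HiggsLattice.Site P 0, Mp b * ∑ u ∈ F, M1 b u * S u
      = ∑ u ∈ F, (∑ b : HiggsLattice.Site P 0, Mp b * M1 b u) * S u := by
    calc ∑ b : HiggsLattice.Site P 0, Mp b * ∑ u ∈ F, M1 b u * S u
        = ∑ b : HiggsLattice.Site P 0, ∑ u ∈ F, Mp b * M1 b u * S u := by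
          refine Finset.sum_congr rfl fun b _ => ?_
          rw [Finset.mul_sum]
          exact Finset.sum_congr rfl fun u _ => by ring
      _ = ∑ u ∈ F, ∑ b : HiggsLattice.Site P 0, Mp b * M1 b u * S u := Finset.sum_comm
      _ = _ := by
          refine Finset.sum_congr rfl fun u _ => ?_
          rw [Finset.sum_mul]
  rw [hfub]
  have hp1 : 1 < p + 1 := by linarith
  calc ∑ u ∈ F, (∑ b : HiggsLattice.Site P 0, Mp b * M1 b u) * S u
      ≤ ∑ u ∈ F, Mc u * M2 u :=
        Finset.sum_le_sum fun u hu => mul_le_mul (hcomp u) (hS2 u hu) (hS0 u hu)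
          ((Finset.sum_nonneg fun b _ => mul_nonneg (majorant_nonneg hc₀ z b) (majorant_nonneg hc₁ b u)).trans (hcomp u))
    _ ≤ _ := face_conv_majorant_le hL hδ2 hδ21 hp1 hs hC₁0 hc₂ hF z y


end Pending

end Literature.MathematicalPhysics.QuantumFieldTheory.Balaban1983to89.B3Op116FaceSums

end
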